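import Literature.AlgebraicGeometry.Motives.Varieties
import Mathlib.AlgebraicGeometry.Geometrically.Reduced
import Mathlib.RingTheory.Unramified.LocalStructure
import Mathlib.RingTheory.Unramified.Field
import Mathlib.RingTheory.Localization.FractionRing
import HarnessLib

/-!
# Discharged fact: smooth projective varieties are geometrically integral (Stacks 056T)

`Literature.AlgebraicGeometry.Motives.Varieties` records as a named fact
(`Literature.IsSmoothProjective.geometricallyIntegral : Prop`) that the structure morphism `X → Spec k`
of a smooth projective variety (`Literature.IsSmoothProjective n X`: smooth of relative dimension `n`,
projective, geometrically irreducible over `k`) is geometrically integral. This file proves it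
(`Literature.AlgebraicGeometry.Motives.IsSmoothProjective.geometricallyIntegral_holds`), so users holding
`(h : IsSmoothProjective.geometricallyIntegral)` can discharge the hypothesis, and then also
discharges the dependent named fact `Literature.AlgebraicGeometry.Motives.IsSmoothProjective.isIntegral`
(`Literature.AlgebraicGeometry.Motives.IsSmoothProjective.isIntegral_holds`, by the interim proof preserved in `Varieties`).
Only the fields `smoothOfRelativeDimension` and `geometricallyIrreducible` are used; the general
statements are `Literature.AlgebraicGeometry.Motives.geometricallyReduced_of_smooth` (a scheme smooth over a field is
geometrically reduced) and Mathlib's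
`AlgebraicGeometry.GeometricallyIntegral.of_geometricallyReduced_of_geometricallyIrreducible`.

## Sources and proof

The statement is the reducedness part of Stacks Project, Tag 056T ("Let `k` be a field. Let `X`
be a scheme smooth over `k`. Then `X` is geometrically regular, geometrically normal, and
geometrically reduced over `k`."), equivalently Görtz–Wedhorn, *Algebraic Geometry I* (2nd ed.),
Cor. 6.32, p. 199 (for `X` locally of finite type over `k`: smooth ⇔ geometrically regular) and
*Algebraic Geometry II*, proof of Prop. 18.78, p. 108 ("Any smooth `k`-scheme is geometrically
regular and in particular geometrically reduced"). The printed proofs go through regularity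
(Görtz–Wedhorn I, Lemma 6.26, p. 196: smooth at `x` ⇒ `𝒪_{X,x}` regular, by the Jacobian
criterion; regular local rings are domains). Mathlib (pinned revision) links smoothness neither
to `IsRegularLocalRing` nor regular local rings to domains, so the formal proof takes the
local-structure route, with the same base-change skeleton:

* `Literature.AlgebraicGeometry.Motives.isReduced_of_etale_of_isDomain`: an étale algebra `B` over a domain `T` is reduced —
  `B` is `T`-flat, so `B ↪ Frac(T) ⊗[T] B`, which is unramified and essentially of finite type
  over the field `Frac(T)`, hence reduced (Görtz–Wedhorn II, Prop. 18.24 / Rem. 18.25, p. 80: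
  unramified over a field ⇔ finite product of finite separable extensions; Mathlib
  `Algebra.FormallyUnramified.isReduced_of_field`).
* `Literature.AlgebraicGeometry.Motives.isReduced_of_smooth_of_field`: a smooth algebra `A` over a field `K` is reduced — a
  smooth algebra is Zariski-locally standard étale over a polynomial ring `K[x₁, …, xₙ]`
  (Görtz–Wedhorn II, Thm. 18.56 (i)⇔(ii), p. 94; Mathlib
  `Algebra.IsSmoothAt.exists_isStandardEtale_mvPolynomial`), so the annihilator of a nilpotent
  element is contained in no maximal ideal.
* `Literature.AlgebraicGeometry.Motives.isReduced_of_smooth_over_field`: a scheme smooth over `Spec K` is reduced (affine cover,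
  `HasRingHomProperty.Spec_iff`).
* `Literature.AlgebraicGeometry.Motives.geometricallyReduced_of_smooth`: `Smooth` is stable under base change, so a morphism to
  `Spec K` which is smooth is `GeometricallyReduced` (Stacks 056T).
* `Literature.AlgebraicGeometry.Motives.IsSmoothProjective.geometricallyIntegral_holds` and `…isIntegral_holds`: combine with
  geometric irreducibility (Mathlib `of_geometricallyReduced_of_geometricallyIrreducible`,
  `GeometricallyIntegral.isIntegral_of_subsingleton`; Stacks 0366).

## References

* The Stacks Project, Tags 056T (schemes smooth over fields are geometrically reduced),
  0366 (geometrically integral schemes). [StacksProject]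
* U. Görtz, T. Wedhorn, *Algebraic Geometry I: Schemes*, 2nd ed. (2020),
  doi:10.1007/978-3-658-30733-2: Lemma 6.26 (p. 196), Cor. 6.32 (p. 199). [GortzWedhorn2020]
* U. Görtz, T. Wedhorn, *Algebraic Geometry II: Cohomology of Schemes* (2023),
  doi:10.1007/978-3-658-43031-3: Prop. 18.24 and Rem. 18.25 (p. 80), Thm. 18.56 (p. 94),
  proof of Prop. 18.78 (p. 108). [GortzWedhorn2023]
-/

universe u

open CategoryTheory AlgebraicGeometry TensorProduct

namespace Literature.AlgebraicGeometry.Motives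

/-- An étale algebra over an integral domain is reduced: `B` is flat over `T`, hence embeds
into `Frac(T) ⊗[T] B`, which is unramified and essentially of finite type over the field
`Frac(T)` and therefore reduced (after base change to an algebraic closure it is a finite
product of copies of the field). [cite: GortzWedhorn2023, Prop. 18.24 and Remark 18.25, p. 80] -/
theorem isReduced_of_etale_of_isDomain (T B : Type*) [CommRing T] [IsDomain T] [CommRing B]
    [Algebra T B] [Algebra.Etale T B] : IsReduced B := by
  let L := FractionRing T
  have : IsReduced (L ⊗[T] B) := Algebra.FormallyUnramified.isReduced_of_field L (L ⊗[T] B)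
  let g : B →ₐ[T] L ⊗[T] B := Algebra.TensorProduct.includeRight
  have hg : Function.Injective g := by
    have : ⇑g = (LinearMap.rTensor B (Algebra.ofId T L).toLinearMap).comp
        (Algebra.TensorProduct.lid T B).symm.toLinearMap := by
      ext x; simp [g]
    rw [this]
    exact (Module.Flat.rTensor_preserves_injective_linearMap _
      (IsFractionRing.injective T L)).comp (Algebra.TensorProduct.lid T B).symm.injective
  exact isReduced_of_injective g hg

/-- A smooth algebra over a field is reduced (Stacks 056T; it is even regular, Görtz–Wedhorn I,
Cor. 6.32). Proof: if `a` is nilpotent with proper annihilator, choose a maximal ideal `m` above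
the annihilator and `f ∉ m` with `A[1/f]` standard étale over some `K[x₁, …, xₙ]`
(`Algebra.IsSmoothAt.exists_isStandardEtale_mvPolynomial`, the local structure of smooth
algebras); `A[1/f]` is reduced by `isReduced_of_etale_of_isDomain`, so `fᵏ a = 0` for some `k`,
forcing `f ∈ m`, a contradiction. [cite: GortzWedhorn2023, Thm. 18.56 (i)⇔(ii), p. 94] [cite: GortzWedhorn2020, Cor. 6.32, p. 199] [cite: StacksProject, Tag 056T] -/
theorem isReduced_of_smooth_of_field (K A : Type*) [Field K] [CommRing A] [Algebra K A]
    [Algebra.Smooth K A] : IsReduced A := by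
  refine ⟨fun a ha ↦ ?_⟩
  by_contra h0
  have hI : (Submodule.span A {a}).annihilator ≠ ⊤ := by
    intro htop
    apply h0
    have h1 : (1 : A) ∈ (Submodule.span A {a}).annihilator := htop ▸ Submodule.mem_top
    rw [Submodule.mem_annihilator_span_singleton] at h1
    simpa using h1
  obtain ⟨m, hm, hIm⟩ := Ideal.exists_le_maximal _ hI
  obtain ⟨f, hfm, n, _, _, _⟩ :=
    Algebra.IsSmoothAt.exists_isStandardEtale_mvPolynomial (R := K) (p := m)
  have : IsReduced (Localization.Away f) :=
    isReduced_of_etale_of_isDomain (MvPolynomial (Fin n) K) (Localization.Away f)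
  have h1 : algebraMap A (Localization.Away f) a = 0 := (ha.map _).eq_zero
  rw [IsLocalization.map_eq_zero_iff (.powers f)] at h1
  obtain ⟨⟨_, k, rfl⟩, hk⟩ := h1
  refine hfm (hm.isPrime.mem_of_pow_mem k (hIm ?_))
  rw [Submodule.mem_annihilator_span_singleton]
  simpa using hk

/-- A scheme smooth over a field is reduced (Stacks 056T; Görtz–Wedhorn I, Cor. 6.32: it is even
geometrically regular), by reduction to the affine case `isReduced_of_smooth_of_field` over an
affine open cover. [cite: StacksProject, Tag 056T] [cite: GortzWedhorn2020, Lemma 6.26 and Cor. 6.32, pp. 196–199] -/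
theorem isReduced_of_smooth_over_field {K : Type u} [Field K] {X : Scheme.{u}}
    (f : X ⟶ Spec (.of K)) [Smooth f] : IsReduced X := by
  wlog hX : ∃ R, X = Spec R generalizing X
  · have : ∀ i, IsReduced (X.affineCover.X i) := fun i ↦
      this (X.affineCover.f i ≫ f) ⟨_, rfl⟩
    exact IsReduced.of_openCover X X.affineCover
  obtain ⟨R, rfl⟩ := hX
  obtain ⟨φ, rfl⟩ := Spec.map_surjective f
  have hφ : φ.hom.Smooth := (HasRingHomProperty.Spec_iff (P := @Smooth)).mp ‹_›
  algebraize [φ.hom]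
  have : IsReduced R := isReduced_of_smooth_of_field K R
  infer_instance

/-- A smooth morphism to the spectrum of a field is geometrically reduced: smoothness is stable
under base change and schemes smooth over a field are reduced (`isReduced_of_smooth_over_field`).
This is the reducedness part of Stacks Tag 056T ("Let `X` be a scheme smooth over a field `k`.
Then `X` is geometrically regular, geometrically normal, and geometrically reduced over `k`").
[cite: StacksProject, Tag 056T] [cite: GortzWedhorn2023, proof of Prop. 18.78, p. 108] -/
theorem geometricallyReduced_of_smooth {K : Type u} [Field K] {X : Scheme.{u}}
    (f : X ⟶ Spec (.of K)) [Smooth f] : GeometricallyReduced f := by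
  refine ⟨fun L _ y Z fst snd hP ↦ ?_⟩
  have : Smooth snd := MorphismProperty.of_isPullback hP ‹Smooth f›
  exact isReduced_of_smooth_over_field snd

variable {k : Type u} [Field k] {n : ℕ} {X : SchemeOver k}

/-- Discharge of the named fact `IsSmoothProjective.geometricallyIntegral`: `X → Spec k` is
smooth (of relative dimension `n`), hence geometrically reduced (`geometricallyReduced_of_smooth`,
Stacks 056T), and geometrically irreducible by assumption, hence geometrically integral
(Mathlib `GeometricallyIntegral.of_geometricallyReduced_of_geometricallyIrreducible`).
[cite: StacksProject, Tag 056T] [cite: GortzWedhorn2023, proof of Prop. 18.78, p. 108] -/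
theorem IsSmoothProjective.geometricallyIntegral_holds :
    IsSmoothProjective.geometricallyIntegral (n := n) (X := X) := by
  intro h
  have := h.smoothOfRelativeDimension
  have : Smooth X.hom := SmoothOfRelativeDimension.smooth n X.hom
  have := h.geometricallyIrreducible
  have : GeometricallyReduced X.hom := geometricallyReduced_of_smooth X.hom
  exact GeometricallyIntegral.of_geometricallyReduced_of_geometricallyIrreducible X.hom

/-- Discharge of the named fact `IsSmoothProjective.isIntegral` (the interim proof preserved in
`Varieties`): a smooth projective variety is geometrically integral
(`IsSmoothProjective.geometricallyIntegral_holds`), and a scheme geometrically integral over a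
field is integral (Mathlib `GeometricallyIntegral.isIntegral_of_subsingleton`; Stacks 0366).
[cite: StacksProject, Section 0366 (geometrically integral ⇒ integral)] [cite: StacksProject, Tag 056T] -/
theorem IsSmoothProjective.isIntegral_holds :
    IsSmoothProjective.isIntegral (n := n) (X := X) := by
  intro h
  have := IsSmoothProjective.geometricallyIntegral_holds h
  exact GeometricallyIntegral.isIntegral_of_subsingleton X.hom

end Literature.AlgebraicGeometry.Motives
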